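import Summits.ResolutionOfSingularities.ResolutionOfSingularities.Theorems.FrobeniusLadderFInjectiveMacaulayficationPinchFloorFull
import HarnessLib

/-!
# (T-I3, habitat #3a input side) THE VERTEX OF THE QUARTIC DOUBLE POINT `x² + y⁴ + u⁴ + t⁴ − s⁴` IS F-PURE (FULL CLAUSE) FOR EVERY PRIME `p ≥ 5`: a THREE-variable stage 2
# (crux `FInjectiveMacaulayfication` stmt-ResolutionOfSingularities-15315, chain w45a; `Lines/T-I3-firststep.md` §1/§3; seat res-L1-w45a-lead-1 g11)

[OURS · L1 W4.5a] Support file (`--supports stmt-ResolutionOfSingularities-15315 --as helper`); def-free; UNCONDITIONAL; no named fact; NOT a statement of any manuscript. Input-side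
legality tool for the next T″ habitat; evidence for nothing beyond itself; T″ and the F-half OPEN; nothing of the crux proved. AI-written (AI review is weaker than expert review).

For `f = X₄² + c`, `c = X₀⁴ + X₁⁴ + X₂⁴ − X₃⁴`: stage 1 (✓p678024 `c_pow_mem`) gives `c^m ∈ (T)` (`m = (p−1)/2`) for every `∂`-stable `T ∋ f^{p−1}`; stage 2 applies
`∂₂^{4c′} ∂₁^{4b} ∂₀^{4a}` with `a + b + c′ = m`, `4a, 4b, 4c′ ≤ p − 1` (possible for every `p ≥ 5` with THREE variables — two do not suffice when `p ≡ 3 (mod 4)`): the only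
survivor of `c^m = Σ C(m,j)X₀^{4j}r^{m−j}` is `j = a`, then of `r^{b+c′}` is the `X₁^{4b}`-term, then of `r′^{c′}` the `X₂^{4c′}`-term: the result is the nonzero integer
`C(m,a)(4a)!·C(b+c′,b)(4b)!·(4c′)!`.
* §1 passive-factor survivor/vanishing lemmas with exponent 4 (`L1`, `L2`, `L3`), index-generic.
* §2 ★★ `hcert_quartic` (every `∂`-stable `T ∋ f^{p−1}` contains `1`; `p ≥ 5`), `clause_quartic`, ★★ `fullCl_stalk_quartic` (FULL at every closed point, given `f` prime),
  `prime_f4` (`2 ≠ 0`; Eisenstein-type at the rational point `(1,0,0,1)`), ★★★ `fullCl_stalk_quarticBed` (the bed `x² + y⁴ + u⁴ + t⁴ − s⁴` is FULL at every closed point, `p ≥ 5`).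
[cite: Fedder1983, Thm. 1.12 (context)] [folklore computation]
-/

-- single-problem summit: the doubled namespace component is forced
set_option linter.dupNamespace false

noncomputable section

open MvPolynomial

namespace Summit.ResolutionOfSingularities.ResolutionOfSingularities.Theorems.FInjectiveMacaulayfication.QuarticVertexFull

open Summit.ResolutionOfSingularities.ResolutionOfSingularities.Theorems.FInjectiveMacaulayfication
open AlgebraicGeometry SliceableCentre X2Cubic4VertexFull

variable (k : Type) [Field k]

/-! ## §1 Survivor and vanishing lemmas with a passive factor -/

/-- **L1 (vanishing)**: `∂_j^{4b}(q·r^m) = 0` for `m < b`, `r = X_j⁴ + r′`, `∂_j r′ = ∂_j q = 0`. [OURS · vanishing] -/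
theorem L1_zero (j : Fin 5) (b m : ℕ) (hm : m < b) (q r r' : MvPolynomial (Fin 5) k) (hq : pderiv j q = 0) (hr : r = X j ^ 4 + r')
    (hr'j : pderiv j r' = 0) : (fun x => pderiv j x)^[4 * b] (q * r ^ m) = 0 := by
  have hcof : ∀ n : ℕ, pderiv j (q * r' ^ n : MvPolynomial (Fin 5) k) = 0 := fun n => by
    rw [Derivation.leibniz, Derivation.leibniz_pow, hr'j, hq]
    simp
  have hexp : q * r ^ m = (Finset.range (m + 1)).sum fun l => (m.choose l : MvPolynomial (Fin 5) k) * (X j ^ (4 * l) * (q * r' ^ (m - l))) := by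
    rw [hr, add_pow, Finset.mul_sum]
    refine Finset.sum_congr rfl fun l _ => ?_
    rw [← pow_mul]
    ring
  rw [hexp, iterate_pderiv_finset_sum]
  refine Finset.sum_eq_zero fun l hl => ?_
  rw [iterate_pderiv_natCast_mul, X2Cubic4FloorFullCert.iterate_pderiv_X_pow_mul j _ (hcof _) (4 * b) (4 * l),
    (Nat.descFactorial_eq_zero_iff_lt).mpr (by have := Finset.mem_range.mp hl; omega)]
  simp

/-- **L1 (survivor)**: `∂_j^{4b}(q·r^b) = (4b)!·q` (`r = X_j⁴ + r′`, `∂_j r′ = ∂_j q = 0`). [OURS · survivor] -/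
theorem L1_self (j : Fin 5) (b : ℕ) (q r r' : MvPolynomial (Fin 5) k) (hq : pderiv j q = 0) (hr : r = X j ^ 4 + r') (hr'j : pderiv j r' = 0) :
    (fun x => pderiv j x)^[4 * b] (q * r ^ b) = ((4 * b).factorial : MvPolynomial (Fin 5) k) * q := by
  have hcof : ∀ n : ℕ, pderiv j (q * r' ^ n : MvPolynomial (Fin 5) k) = 0 := fun n => by
    rw [Derivation.leibniz, Derivation.leibniz_pow, hr'j, hq]
    simp
  have hexp : q * r ^ b = (Finset.range (b + 1)).sum fun l => (b.choose l : MvPolynomial (Fin 5) k) * (X j ^ (4 * l) * (q * r' ^ (b - l))) := by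
    rw [hr, add_pow, Finset.mul_sum]
    refine Finset.sum_congr rfl fun l _ => ?_
    rw [← pow_mul]
    ring
  rw [hexp, iterate_pderiv_finset_sum, Finset.sum_eq_single b]
  · rw [iterate_pderiv_natCast_mul, X2Cubic4FloorFullCert.iterate_pderiv_X_pow_mul j _ (hcof _) (4 * b) (4 * b), Nat.descFactorial_self, Nat.sub_self, Nat.sub_self,
      Nat.choose_self]
    simp
  · intro l hl hne
    rw [iterate_pderiv_natCast_mul, X2Cubic4FloorFullCert.iterate_pderiv_X_pow_mul j _ (hcof _) (4 * b) (4 * l),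
      (Nat.descFactorial_eq_zero_iff_lt).mpr (by have := Finset.mem_range.mp hl; omega)]
    simp
  · intro hnot
    exact absurd (Finset.mem_range.mpr (Nat.lt_succ_self b)) hnot

/-- **L2 (vanishing)**: `∂_j^{4b}(∂_i^{4a}(q·c^m)) = 0` for `m < a + b` (`c = X_i⁴ + r`, `r = X_j⁴ + r′`, `∂_i r = ∂_j r′ = 0`, `q` passive, `i ≠ j`). [OURS · vanishing] -/
theorem L2_zero (i j : Fin 5) (hij : i ≠ j) (a b m : ℕ) (hm : m < a + b) (q c r r' : MvPolynomial (Fin 5) k) (hqi : pderiv i q = 0) (hqj : pderiv j q = 0)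
    (hc : c = X i ^ 4 + r) (hr : r = X j ^ 4 + r') (hri : pderiv i r = 0) (hr'j : pderiv j r' = 0) :
    (fun x => pderiv j x)^[4 * b] ((fun x => pderiv i x)^[4 * a] (q * c ^ m)) = 0 := by
  have hcof : ∀ n : ℕ, pderiv i (q * r ^ n : MvPolynomial (Fin 5) k) = 0 := fun n => by
    rw [Derivation.leibniz, Derivation.leibniz_pow, hri, hqi]
    simp
  have hexp : q * c ^ m = (Finset.range (m + 1)).sum fun l => (m.choose l : MvPolynomial (Fin 5) k) * (X i ^ (4 * l) * (q * r ^ (m - l))) := by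
    rw [hc, add_pow, Finset.mul_sum]
    refine Finset.sum_congr rfl fun l _ => ?_
    rw [← pow_mul]
    ring
  rw [hexp, iterate_pderiv_finset_sum, iterate_pderiv_finset_sum]
  refine Finset.sum_eq_zero fun l hl => ?_
  rw [iterate_pderiv_natCast_mul, X2Cubic4FloorFullCert.iterate_pderiv_X_pow_mul i _ (hcof _) (4 * a) (4 * l), iterate_pderiv_natCast_mul, iterate_pderiv_natCast_mul]
  by_cases hla : l < a
  · rw [(Nat.descFactorial_eq_zero_iff_lt).mpr (by omega)]
    simp
  · have hl' := Finset.mem_range.mp hl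
    have hpass : pderiv j (X i ^ (4 * l - 4 * a) * q : MvPolynomial (Fin 5) k) = 0 := by
      rw [Derivation.leibniz, Derivation.leibniz_pow, pderiv_X_of_ne hij, hqj]; simp
    rw [show X i ^ (4 * l - 4 * a) * (q * r ^ (m - l)) = (X i ^ (4 * l - 4 * a) * q) * r ^ (m - l) by ring,
      L1_zero k j b (m - l) (by omega) _ r r' hpass hr hr'j]
    simp

/-- **L2 (survivor)**: `∂_j^{4b}(∂_i^{4a}(q·c^{a+b})) = C(a+b,a)(4a)!(4b)!·q`. [OURS · survivor] -/
theorem L2_self (i j : Fin 5) (hij : i ≠ j) (a b : ℕ) (q c r r' : MvPolynomial (Fin 5) k) (hqi : pderiv i q = 0) (hqj : pderiv j q = 0)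
    (hc : c = X i ^ 4 + r) (hr : r = X j ^ 4 + r') (hri : pderiv i r = 0) (hr'j : pderiv j r' = 0) :
    (fun x => pderiv j x)^[4 * b] ((fun x => pderiv i x)^[4 * a] (q * c ^ (a + b))) =
      (((a + b).choose a * (4 * a).factorial * (4 * b).factorial : ℕ) : MvPolynomial (Fin 5) k) * q := by
  have hcof : ∀ n : ℕ, pderiv i (q * r ^ n : MvPolynomial (Fin 5) k) = 0 := fun n => by
    rw [Derivation.leibniz, Derivation.leibniz_pow, hri, hqi]
    simp
  have hexp : q * c ^ (a + b) = (Finset.range (a + b + 1)).sum fun l => ((a + b).choose l : MvPolynomial (Fin 5) k) * (X i ^ (4 * l) * (q * r ^ (a + b - l))) := by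
    rw [hc, add_pow, Finset.mul_sum]
    refine Finset.sum_congr rfl fun l _ => ?_
    rw [← pow_mul]
    ring
  rw [hexp, iterate_pderiv_finset_sum, iterate_pderiv_finset_sum, Finset.sum_eq_single a]
  · rw [iterate_pderiv_natCast_mul, X2Cubic4FloorFullCert.iterate_pderiv_X_pow_mul i _ (hcof _) (4 * a) (4 * a), Nat.descFactorial_self, Nat.sub_self,
      show a + b - a = b by omega, iterate_pderiv_natCast_mul, iterate_pderiv_natCast_mul, pow_zero, one_mul, L1_self k j b q r r' hqj hr hr'j]
    push_cast
    ring
  · intro l hl hne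
    rw [iterate_pderiv_natCast_mul, X2Cubic4FloorFullCert.iterate_pderiv_X_pow_mul i _ (hcof _) (4 * a) (4 * l), iterate_pderiv_natCast_mul, iterate_pderiv_natCast_mul]
    rcases lt_or_gt_of_ne hne with hlt | hgt
    · rw [(Nat.descFactorial_eq_zero_iff_lt).mpr (by omega)]
      simp
    · have hl' := Finset.mem_range.mp hl
      have hpass : pderiv j (X i ^ (4 * l - 4 * a) * q : MvPolynomial (Fin 5) k) = 0 := by
        rw [Derivation.leibniz, Derivation.leibniz_pow, pderiv_X_of_ne hij, hqj]; simp
      rw [show X i ^ (4 * l - 4 * a) * (q * r ^ (a + b - l)) = (X i ^ (4 * l - 4 * a) * q) * r ^ (a + b - l) by ring,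
        L1_zero k j b (a + b - l) (by omega) _ r r' hpass hr hr'j]
      simp
  · intro hnot
    exact absurd (Finset.mem_range.mpr (by omega : a < a + b + 1)) hnot

/-- ★ **L3 (survivor), the three-variable stage 2**: `∂_l^{4c′}(∂_j^{4b}(∂_i^{4a}(c^{a+b+c′}))) = C(a+b+c′,a)(4a)!·C(b+c′,b)(4b)!(4c′)!` for `c = X_i⁴ + r`, `r = X_j⁴ + r′`,
`r′ = X_l⁴ + r″` with `∂_i r = 0`, `∂_j r′ = 0`, `∂_l r″ = 0` (`i, j, l` distinct). [OURS · folklore computation] -/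
theorem L3_self (i j l : Fin 5) (hij : i ≠ j) (hil : i ≠ l) (hjl : j ≠ l) (a b c' : ℕ) (c r r' r'' : MvPolynomial (Fin 5) k)
    (hc : c = X i ^ 4 + r) (hr : r = X j ^ 4 + r') (hr' : r' = X l ^ 4 + r'') (hri : pderiv i r = 0) (hr'j : pderiv j r' = 0) (hr''l : pderiv l r'' = 0) :
    (fun x => pderiv l x)^[4 * c'] ((fun x => pderiv j x)^[4 * b] ((fun x => pderiv i x)^[4 * a] (c ^ (a + b + c')))) =
      (((a + b + c').choose a * (4 * a).factorial * ((b + c').choose b * (4 * b).factorial * (4 * c').factorial) : ℕ) : MvPolynomial (Fin 5) k) := by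
  have hrpow : ∀ n : ℕ, pderiv i (r ^ n : MvPolynomial (Fin 5) k) = 0 := fun n => by rw [Derivation.leibniz_pow, hri, smul_zero, smul_zero]
  have hexp : c ^ (a + b + c') = (Finset.range (a + b + c' + 1)).sum fun n => ((a + b + c').choose n : MvPolynomial (Fin 5) k) * (X i ^ (4 * n) * r ^ (a + b + c' - n)) := by
    rw [hc, add_pow]
    refine Finset.sum_congr rfl fun n _ => ?_
    rw [← pow_mul]
    ring
  rw [hexp, iterate_pderiv_finset_sum, iterate_pderiv_finset_sum, iterate_pderiv_finset_sum, Finset.sum_eq_single a]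
  · -- the survivor `n = a`: passive factor `q = C(..)·(4a)!·X_i^0 = constant`
    rw [iterate_pderiv_natCast_mul, X2Cubic4FloorFullCert.iterate_pderiv_X_pow_mul i _ (hrpow _) (4 * a) (4 * a), Nat.descFactorial_self, Nat.sub_self,
      show a + b + c' - a = b + c' by omega, iterate_pderiv_natCast_mul, iterate_pderiv_natCast_mul, iterate_pderiv_natCast_mul, iterate_pderiv_natCast_mul, pow_zero, one_mul,
      show (r ^ (b + c') : MvPolynomial (Fin 5) k) = 1 * r ^ (b + c') by rw [one_mul],
      L2_self k j l hjl b c' 1 r r' r'' (by simp) (by simp) hr hr' hr'j hr''l, mul_one]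
    push_cast
    ring
  · intro n hn hne
    rw [iterate_pderiv_natCast_mul, X2Cubic4FloorFullCert.iterate_pderiv_X_pow_mul i _ (hrpow _) (4 * a) (4 * n), iterate_pderiv_natCast_mul, iterate_pderiv_natCast_mul,
      iterate_pderiv_natCast_mul, iterate_pderiv_natCast_mul]
    rcases lt_or_gt_of_ne hne with hlt | hgt
    · rw [(Nat.descFactorial_eq_zero_iff_lt).mpr (by omega)]
      simp
    · have hn' := Finset.mem_range.mp hn
      have hqj : pderiv j (X i ^ (4 * n - 4 * a) : MvPolynomial (Fin 5) k) = 0 := by rw [Derivation.leibniz_pow, pderiv_X_of_ne hij]; simp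
      have hql : pderiv l (X i ^ (4 * n - 4 * a) : MvPolynomial (Fin 5) k) = 0 := by rw [Derivation.leibniz_pow, pderiv_X_of_ne hil]; simp
      rw [L2_zero k j l hjl b c' (a + b + c' - n) (by omega) (X i ^ (4 * n - 4 * a)) r r' r'' hqj hql hr hr' hr'j hr''l]
      simp
  · intro hnot
    exact absurd (Finset.mem_range.mpr (by omega : a < a + b + c' + 1)) hnot

/-! ## §2 The certificate for `f = X₄² + X₀⁴ + X₁⁴ + X₂⁴ − X₃⁴`, and FULLness -/

/-- The exponents: for a prime `p ∉ {2,3}` there are `a, b, c′` with `a + b + c′ = (p−1)/2`, `4a, 4b, 4c′ < p` and `(p−1)/2 < p`. [elementary] -/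
theorem exponents (p : ℕ) (hp : p.Prime) (hp2 : p ≠ 2) (hp3 : p ≠ 3) :
    ∃ a b c' : ℕ, a + b + c' = (p - 1) / 2 ∧ 4 * a < p ∧ 4 * b < p ∧ 4 * c' < p ∧ (p - 1) / 2 < p := by
  have h2 := hp.two_le
  have hodd : p % 2 = 1 := hp.eq_two_or_odd.resolve_left hp2
  have h5 : 5 ≤ p := by
    rcases Nat.lt_or_ge p 5 with h | h
    · interval_cases p <;> simp_all (config := {decide := true})
    · exact h
  refine ⟨min ((p - 1) / 2) ((p - 1) / 4), min ((p - 1) / 2 - min ((p - 1) / 2) ((p - 1) / 4)) ((p - 1) / 4),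
    (p - 1) / 2 - min ((p - 1) / 2) ((p - 1) / 4) - min ((p - 1) / 2 - min ((p - 1) / 2) ((p - 1) / 4)) ((p - 1) / 4), ?_, ?_, ?_, ?_, ?_⟩ <;> omega

/-- ★★ **THE `p`-UNIFORM DERIVATIVE CERTIFICATE FOR THE QUARTIC VERTEX** (`f = X₄² + X₀⁴ + X₁⁴ + X₂⁴ − X₃⁴`, every prime `p ∉ {2,3}`): every `∂`-stable `T ∋ f^{p−1}` has `1 ∈ (T)`.
[OURS; cite: Fedder1983, Thm. 1.12 (context)] -/
theorem hcert_quartic (p : ℕ) [Fact p.Prime] [CharP k p] (hp2 : p ≠ 2) (hp3 : p ≠ 3) (f : MvPolynomial (Fin 5) k)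
    (hf : f = X 4 ^ 2 + X 0 ^ 4 + X 1 ^ 4 + X 2 ^ 4 - X 3 ^ 4) :
    ∀ T : Set (MvPolynomial (Fin 5) k), f ^ (p - 1) ∈ T → (∀ s ∈ T, ∀ i : Fin 5, pderiv i s ∈ T) → (1 : MvPolynomial (Fin 5) k) ∈ Ideal.span T := by
  intro T hfT hT
  have hp : p.Prime := Fact.out
  obtain ⟨a, b, c', habc, ha, hb, hc', hh⟩ := exponents p hp hp2 hp3
  -- stage 1
  have hf' : f = X 4 ^ 2 + (X 0 ^ 4 + (X 1 ^ 4 + (X 2 ^ 4 + (-(X 3 ^ 4))))) := by rw [hf]; ring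
  have hc4 : pderiv 4 (X 0 ^ 4 + (X 1 ^ 4 + (X 2 ^ 4 + (-(X 3 ^ 4)))) : MvPolynomial (Fin 5) k) = 0 := by
    simp only [map_add, map_neg, Derivation.leibniz_pow, pderiv_X_of_ne (show (0 : Fin 5) ≠ 4 by decide), pderiv_X_of_ne (show (1 : Fin 5) ≠ 4 by decide),
      pderiv_X_of_ne (show (2 : Fin 5) ≠ 4 by decide), pderiv_X_of_ne (show (3 : Fin 5) ≠ 4 by decide), smul_zero, add_zero, neg_zero]
  have hcI := c_pow_mem k p hp2 f _ hf' hc4 T hfT hT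
  rw [← habc] at hcI
  -- stage 2
  have hri : pderiv 0 (X 1 ^ 4 + (X 2 ^ 4 + (-(X 3 ^ 4))) : MvPolynomial (Fin 5) k) = 0 := by
    simp only [map_add, map_neg, Derivation.leibniz_pow, pderiv_X_of_ne (show (1 : Fin 5) ≠ 0 by decide), pderiv_X_of_ne (show (2 : Fin 5) ≠ 0 by decide),
      pderiv_X_of_ne (show (3 : Fin 5) ≠ 0 by decide), smul_zero, add_zero, neg_zero]
  have hr'j : pderiv 1 (X 2 ^ 4 + (-(X 3 ^ 4)) : MvPolynomial (Fin 5) k) = 0 := by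
    simp only [map_add, map_neg, Derivation.leibniz_pow, pderiv_X_of_ne (show (2 : Fin 5) ≠ 1 by decide), pderiv_X_of_ne (show (3 : Fin 5) ≠ 1 by decide),
      smul_zero, add_zero, neg_zero]
  have hr''l : pderiv 2 (-(X 3 ^ 4) : MvPolynomial (Fin 5) k) = 0 := by
    rw [map_neg, Derivation.leibniz_pow, pderiv_X_of_ne (show (3 : Fin 5) ≠ 2 by decide)]; simp
  have hD := iterate_span_pderiv_mem k T hT 2 (4 * c') (iterate_span_pderiv_mem k T hT 1 (4 * b) (iterate_span_pderiv_mem k T hT 0 (4 * a) hcI))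
  rw [L3_self k 0 1 2 (by decide) (by decide) (by decide) a b c' _ (X 1 ^ 4 + (X 2 ^ 4 + (-(X 3 ^ 4)))) (X 2 ^ 4 + (-(X 3 ^ 4))) (-(X 3 ^ 4))
    rfl rfl rfl hri hr'j hr''l] at hD
  have hN : ((((a + b + c').choose a * (4 * a).factorial * ((b + c').choose b * (4 * b).factorial * (4 * c').factorial) : ℕ)) : k) ≠ 0 := by
    rw [Nat.cast_mul, Nat.cast_mul, Nat.cast_mul, Nat.cast_mul]
    refine mul_ne_zero (mul_ne_zero (choose_cast_ne_zero k p _ _ (by omega) (by omega)) (factorial_cast_ne_zero k p _ ha))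
      (mul_ne_zero (mul_ne_zero (choose_cast_ne_zero k p _ _ (by omega) (by omega)) (factorial_cast_ne_zero k p _ hb)) (factorial_cast_ne_zero k p _ hc'))
  exact mem_of_natCast_mul_mem k hN (Ideal.span T) 1 (by rwa [mul_one])

/-- **The FULL clause at every maximal ideal of `k[X]/(f)`**, `f` the quartic bed, `p ∉ {2,3}`. [OURS · assembly] -/
theorem clause_quartic (p : ℕ) [Fact p.Prime] [CharP k p] (hp2 : p ≠ 2) (hp3 : p ≠ 3) (f : MvPolynomial (Fin 5) k)
    (hf : f = X 4 ^ 2 + X 0 ^ 4 + X 1 ^ 4 + X 2 ^ 4 - X 3 ^ 4) (hf0 : f ≠ 0)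
    (Q : Ideal (MvPolynomial (Fin 5) k ⧸ Ideal.span {f})) [Q.IsMaximal] :
    ∀ d : ℕ, ringKrullDim (Localization.AtPrime Q) = d → ∀ s : Fin d → Localization.AtPrime Q,
      (Ideal.span (Set.range s)).radical.IsMaximal →
        RingTheory.Sequence.IsWeaklyRegular (Localization.AtPrime Q) (List.ofFn s) ∧
        ∀ y : Localization.AtPrime Q, (∃ e : ℕ, y ^ p ^ e ∈ Ideal.span
          ((fun z : Localization.AtPrime Q => z ^ p ^ e) ''
            (Ideal.span (Set.range s) : Set (Localization.AtPrime Q)))) → y ∈ Ideal.span (Set.range s) :=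
  TCaFloorOneFull.clause_at_maximal_of_derivative_certificate p k f hf0 (hcert_quartic k p hp2 hp3 f hf) Q

/-- ★★ **`Y = {x² + y⁴ + u⁴ + t⁴ − s⁴ = 0}` IS FULL AT EVERY CLOSED POINT** given `f` prime (`p ∉ {2,3}`). [OURS · certificate] -/
theorem fullCl_stalk_quartic (p : ℕ) [Fact p.Prime] [CharP k p] (hp2 : p ≠ 2) (hp3 : p ≠ 3) (f : MvPolynomial (Fin 5) k)
    (hf : f = X 4 ^ 2 + X 0 ^ 4 + X 1 ^ 4 + X 2 ^ 4 - X 3 ^ 4) (hprime : Prime f)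
    (y : Spec (.of (MvPolynomial (Fin 5) k ⧸ Ideal.span {f}))) (hy : y.asIdeal.IsMaximal) :
    FullCl p ((Spec (.of (MvPolynomial (Fin 5) k ⧸ Ideal.span {f}))).presheaf.stalk y) := by
  haveI := (Ideal.span_singleton_prime hprime.ne_zero).mpr hprime
  haveI : IsDomain (MvPolynomial (Fin 5) k ⧸ Ideal.span {f}) := Ideal.Quotient.isDomain _
  haveI := hy
  haveI : IsDomain (Localization.AtPrime y.asIdeal) :=
    IsLocalization.isDomain_of_le_nonZeroDivisors _ y.asIdeal.primeCompl_le_nonZeroDivisors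
  have hloc : FullCl p (Localization.AtPrime y.asIdeal) := ⟨inferInstance, clause_quartic k p hp2 hp3 f hf hprime.ne_zero y.asIdeal⟩
  exact WFixAtNonClosedDimTwo.fullCl_of_ringEquiv p (Spec.stalkIso (.of _) y).commRingCatIsoToRingEquiv.symm hloc

/-- **`f = X₄² + X₀⁴ + X₁⁴ + X₂⁴ − X₃⁴` is prime** when `2 ≠ 0`: `T² + C(c)` Eisenstein-type at the rational point `(1,0,0,1)` of `c` (`∂₀c = 4` there). [folklore] -/
theorem prime_f4 (h2 : (2 : k) ≠ 0) (f : MvPolynomial (Fin 5) k) (hf : f = X 4 ^ 2 + X 0 ^ 4 + X 1 ^ 4 + X 2 ^ 4 - X 3 ^ 4) : Prime f := by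
  set e : MvPolynomial (Fin 5) k ≃+* Polynomial (MvPolynomial (Fin 4) k) :=
    ((renameEquiv k (_root_.finRotate 5)).trans (finSuccEquiv k 4)).toRingEquiv with he_def
  have hrot4 : (_root_.finRotate 5) (4 : Fin 5) = 0 := by decide
  have hrot : ∀ j : Fin 4, (_root_.finRotate 5) (Fin.castSucc j) = j.succ := by decide
  have he4 : e (X 4) = Polynomial.X := by
    show finSuccEquiv k 4 (rename _ (X 4)) = _
    rw [rename_X, hrot4]; exact finSuccEquiv_X_zero
  have hej : ∀ j : Fin 4, e (X (Fin.castSucc j)) = Polynomial.C (X j) := fun j => by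
    show finSuccEquiv k 4 (rename _ (X (Fin.castSucc j))) = _
    rw [rename_X, hrot j]; exact finSuccEquiv_X_succ (j := j)
  set c : MvPolynomial (Fin 4) k := X 0 ^ 4 + X 1 ^ 4 + X 2 ^ 4 - X 3 ^ 4 with hc
  have hef : e f = Polynomial.X ^ 2 + Polynomial.C (0 : MvPolynomial (Fin 4) k) * Polynomial.X + Polynomial.C c := by
    rw [hf, map_sub, map_add, map_add, map_add, map_pow, he4, map_pow, map_pow, map_pow, map_pow,
      show (0 : Fin 5) = Fin.castSucc (0 : Fin 4) from rfl, show (1 : Fin 5) = Fin.castSucc (1 : Fin 4) from rfl,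
      show (2 : Fin 5) = Fin.castSucc (2 : Fin 4) from rfl, show (3 : Fin 5) = Fin.castSucc (3 : Fin 4) from rfl, hej, hej, hej, hej, hc]
    simp only [map_add, map_sub, map_pow, map_zero, zero_mul, add_zero]
    ring
  set a : Fin 4 → k := ![1, 0, 0, 1] with ha
  have hba : MvPolynomial.eval a (0 : MvPolynomial (Fin 4) k) = 0 := map_zero _
  have hca : MvPolynomial.eval a c = 0 := by
    rw [hc]
    simp only [map_add, map_sub, map_pow, eval_X, ha, Matrix.cons_val_zero, Matrix.cons_val_one]
    simp only [Matrix.cons_val]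
    ring
  have hder : MvPolynomial.eval a (pderiv 0 c) ≠ 0 := by
    have e1 : pderiv 0 c = 4 * X 0 ^ 3 := by
      rw [hc]
      simp only [map_add, map_sub, Derivation.leibniz_pow, pderiv_X_self, pderiv_X_of_ne (show (1 : Fin 4) ≠ 0 by decide),
        pderiv_X_of_ne (show (2 : Fin 4) ≠ 0 by decide), pderiv_X_of_ne (show (3 : Fin 4) ≠ 0 by decide), smul_eq_mul, mul_one, nsmul_eq_mul]
      push_cast; ring
    rw [e1, map_mul, map_pow, eval_X, ha]
    simp only [Matrix.cons_val_zero, one_pow, mul_one]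
    rw [map_ofNat]
    have h4 : (4 : k) ≠ 0 := by rw [show (4 : k) = 2 * 2 by norm_num]; exact mul_ne_zero h2 h2
    exact h4
  have hirr : Irreducible (e f) := by
    rw [hef]
    exact Literature.AlgebraicGeometry.Motives.SmoothHypersurface.irreducible_X_pow_add_C_mul_X_add_C (d := 2) le_rfl 0 c a hba hca 0 hder
  exact (MulEquiv.prime_iff e).mp hirr.prime

/-- ★★★ **THE QUARTIC BED `Y = {x² + y⁴ + u⁴ + t⁴ − s⁴}` IS FULL AT EVERY CLOSED POINT, every prime `p ≥ 5`** — in particular its vertex is a legal (FULL) base germ for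
T″; together with ⧗ `PinchFloorFull.fullCl_stalk_quartic_yChart` (the point floor's singular charts are FULL) this is the input side of habitat #3a. [OURS · application] -/
theorem fullCl_stalk_quarticBed (p : ℕ) [Fact p.Prime] [CharP k p] (hp2 : p ≠ 2) (hp3 : p ≠ 3) (f : MvPolynomial (Fin 5) k)
    (hf : f = X 4 ^ 2 + X 0 ^ 4 + X 1 ^ 4 + X 2 ^ 4 - X 3 ^ 4)
    (y : Spec (.of (MvPolynomial (Fin 5) k ⧸ Ideal.span {f}))) (hy : y.asIdeal.IsMaximal) :
    FullCl p ((Spec (.of (MvPolynomial (Fin 5) k ⧸ Ideal.span {f}))).presheaf.stalk y) :=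
  fullCl_stalk_quartic k p hp2 hp3 f hf (prime_f4 k (X2Cubic4Specimen.two_three_ne_zero k p hp2 hp3).1 f hf) y hy

end Summit.ResolutionOfSingularities.ResolutionOfSingularities.Theorems.FInjectiveMacaulayfication.QuarticVertexFull

end
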